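import Mathlib
import HarnessLib
import Literature.Analysis.FluidPDE.OctahedralSymmetry
import Literature.MathematicalPhysics.QuantumLattice.EuclideanAction
import Summits.QuantumFields.YangMills.Theses.PencilRigidity
import Summits.QuantumFields.YangMills.Theorems.PencilRigidityShellRigidityExponentReduction
import Summits.QuantumFields.YangMills.Theorems.PencilRigidityShellRigidityAxisLaplace
import Summits.QuantumFields.YangMills.Theorems.PencilRigidityShellRigidityPlanarDiscSections
import Summits.QuantumFields.YangMills.Theorems.PencilRigidityShellRigidityRadialLift
import Summits.QuantumFields.YangMills.Theorems.PencilRigidityShellRigidityConeOfDiscSections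

/-!
# Line `thales-slit-exact-cone-type` — LEAD-b skeleton (reshaped v3) for crux
# `PencilRigidity.ShellRigidity` (stmt-QuantumFields-11685, route-QuantumFields-PencilRigidity)

Second line lead `prover-line-stmt-QuantumFields-11685-b-0`, 2026-08-16.

**Crux (read back).** `K : ℝ⁴ → ℝ` continuous off `0`, `|K x| ≤ C (1 + ‖x‖^(η-10))` for some `η > 0`,
invariant under every signed permutation of the coordinates (`W(B₄)`), pointwise Osterwalder–Schrader
positive across the axis mirror `x₀ = 0` and across the diagonal mirror `x₀ = x₁`
⟹ `K (R x) = K x` for every linear isometry `R` and `x ≠ 0`.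

**The line, reshaped.** FRONT END (shared with line `transverse-smearing-planar-threshold`, whose landed
stubs are IMPORTED, not re-proved): exponent reduction `a = 10 - min η 7 ∈ [3,10)`
(`stub_exponentReduction`, landed); the axis Laplace–Fourier representations of `K` and of the 45°-rotated
kernel `K' = K ∘ R₋₄₅` by finite positive measures `μ_ε`, `μ'_ε` (`stub_axisLaplace`, landed; the axis
clause of `K'` IS the crux's diagonal clause); Thales disc sections of the planar traces from the OTHER
family (`stub_planarDiscSections`, landed: the diagonal frame of `K` is the axis frame of `K'` and vice
versa); the EXACT light cone `μ_ε{p₀ < |p₁|} = 0` from the disc sections (`stub_coneOfDiscSections`, landed by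
lead 1 at 03:2xZ while this skeleton was being written — imported; v3.0's split `stub_discExpMoments` +
`stub_coneRays` is withdrawn).
BACK END (this line's own): `stub_angleBandLimit` — the cone-carried representation continues
`φ ↦ K(t cos φ, t sin φ, y, z)` into ONE chart `{t cos(Re w) e^{-|Im w|} > ε}` with
`|·| ≤ K(t cos α e^{-|ψ|} e₀) ≤ C(1 + (…)^{-a})`, `R_{π/2}`-periodicity closes the contour, the
coefficients of `e^{4ijφ}` die for `4|j| > a` (`a < 12`): `K(t cos φ, t sin φ, y, z) = b₀ + b₁ cos 4φ +
b₂ cos 8φ` with the chart identity at imaginary angle `iχ` (exponent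
`-(t ch χ - ε)p₀ - t sh χ p₁ + i(y p₂ + z p₃)`); and `stub_transversePinch` — in the transverse variable
`ζ = (y,z)` the functions `b_j(t,·)` are continuous, bounded and (limits of) POSITIVE-DEFINITE functions,
the Gaussian/box-smeared top coefficient `B₂ ≥ 0` obeys `B₂ ch 8χ ≤ B₀ + |B₁| ch 4χ + C_h(1 +
(t e^{-|χ|})^{2-a})` (smearing gains the transverse dimension `2`; `a - 2 < 8`) so `B₂ = 0`, an
approximate identity gives `b₂(t,0) = 0`, positive-definiteness `b₂ ≡ 0`; then the axis and DIAGONAL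
charts (`b' = (b₀, -b₁, b₂)`) pinch `|B₁| ch 4χ ≤ B₀`, so `b₁ ≡ 0`: `K(t cos φ, t sin φ, y, z) = K(t,0,y,z)`.
Norm reduction (`RadialLift.norm_reduction`, landed) finishes. Versus the planner's v2: `stub_laplace`,
`stub_thalesSlit`, `stub_boundedOfGrowth` are replaced by the landed imports (ε-family form, no slit
estimate needed: the disc bound is uniform in `t`), `stub_cone_of_slitSections` by the landed cone theorem, and
`stub_so4Finite` + `stub_bandLimitedRigidity` (Casimir count + dressed-KL transfer, XL with a recorded
triage doubt) by `stub_transversePinch` (L, elementary).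

**Where each crux hypothesis is consumed.** H1 continuity — `stub_axisLaplace`, `stub_planarDiscSections`,
`stub_transversePinch`; H2 the bound — `stub_exponentReduction`, then the window `a` in `stub_angleBandLimit`
(type) and `stub_transversePinch` (`a - 2 < 8`, the threshold: `H₈(x) r⁻¹⁸` has `a = 10`); H3 `W(B₄)` — glue
(evenness, parity, swap, `R_{π/2}`, flips; conjugation to `K'`; norm reduction); H4 axis RP —
`stub_axisLaplace` for `K` (and the disc sections of `K'`); H5 DIAGONAL RP — `stub_axisLaplace` for `K'`
(disc sections of `K`, hence the cone of `μ`; and the diagonal chart of the pinch, which kills the mode 4: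
`shellRigidity_false_without_diag`). Disproof.lean (cycle 2) read: §A both clauses used; §B (planar
threshold 8 sharp) is why the mode 8 is killed by GROWTH `a - 2 < 8` after smearing and not by a contour
shift; §C/§D no stub of this file is an instance a recorded witness refutes.
-/

noncomputable section

namespace Summit.QuantumFields.YangMills.Cruxes.ShellRigidity.ThalesSlitExactConeType

open MeasureTheory Complex Real
open scoped InnerProductSpace BigOperators
open Literature.MathematicalPhysics.QuantumLattice
open Literature.Analysis.FluidPDE (signedPermIsometry signedPermIsometry_apply
  isSignedPermIsometry_signedPermIsometry)
open Summit.QuantumFields.YangMills.Theses.PencilRigidity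
open Summit.QuantumFields.YangMills.Cruxes.ShellRigidity.TransverseSmearingPlanarThreshold
  (stub_exponentReduction stub_axisLaplace stub_planarDiscSections stub_coneOfDiscSections
  RadialLift.norm_reduction)

local notation "E4" => EuclideanSpace ℝ (Fin 4)

/-! ## The registered stubs (the only `sorry`s): A = `stub_angleBandLimit`, B = `stub_transversePinch`
(the lead's; to be discharged through its three registered helpers P1–P3 below) -/

/-- **Stub A · the angle band limit with its chart identity (this line's lever; L).** `K : ℝ⁴ → ℝ` with a
decay window `|K x| ≤ C(1 + ‖x‖^{-a})`, `0 < a < 12`, invariant under the rotation `R_{π/2}` of the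
`(0,1)`-plane and under `x₁ ↦ -x₁`, and represented along the time axis, for every level `ε > 0`, by a finite
positive measure `μ ε` carried by the light cone `{p₀ ≥ |p₁|}`:
`K((ε+t)e₀ + v) = ∫ e^{-t p₀ + i⟪v,p⟫} d(μ ε)` (`t ≥ 0`, `v ⊥ e₀`). Then for every `t > 0` and transverse
`(y,z)` the angular trace is a real trigonometric polynomial `b₀ + b₁ cos 4φ + b₂ cos 8φ`, and its value at
the imaginary angle `iχ` is the chart integral at any level `ε < t e^{-|χ|}`.
Why true: the chart `H(w) = ∫ exp(-(t cos w - ε)p₀ + i(t sin w p₁ + y p₂ + z p₃)) d(μ ε)` converges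
absolutely and is holomorphic on the lens `V = {w = α+iψ : t cos α e^{-|ψ|} > ε}` (on the cone
`|e^{i t sin w p₁}| ≤ e^{t |cos α| |sh ψ| p₀}`, and `ch ψ - |sh ψ| = e^{-|ψ|}`; dominated differentiation),
equals `g(α) = K(t cos α, t sin α, y, z)` at real points of `V` (the representation at `v = t sin α e₁ + y e₂
+ z e₃`, time `t cos α = ε + (t cos α - ε)`), and `|H(α+iψ)| ≤ K(t cos α e^{-|ψ|} e₀) ≤ C(1 + (t cos α
e^{-|ψ|})^{-a})`. `g` is continuous?—not needed: `g` is `π/2`-periodic (`hrot`) and even (`hflip`), and ON `V`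
`H(w + π/2) = H(w)` near `Re w = -π/4` and `H(-w) = H(w)` (identity theorem from the real points), so the
Fourier coefficient `c_n = (2/π)∫_{-π/4}^{π/4} g e^{-4inα} dα` is a contour integral that shifts to height
`∓Ψ` INSIDE the one chart (vertical sides cancel), every `Ψ < log(t/(√2 ε))`, i.e. every `Ψ` (`ε` free):
`|c_n| ≤ (C + C (t/√2)^{-a} e^{aΨ}) e^{-4|n|Ψ} → 0` for `4|n| > a`, so `c_n = 0` for `|n| ≥ 3`;
`g - Σ_{|n|≤2} c_n e^{4inα}` is continuous?? (it is: `g = H` on reals) with all Fourier coefficients zero, hence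
zero (`fourierBasis` of `L²(AddCircle (π/2))`); evenness and reality give `b = (c₀, 2c₁, 2c₂)` real; finally
`w ↦ H(w) - (b₀ + b₁ cos 4w + b₂ cos 8w)` vanishes on the real points of the lens, hence at `iχ ∈ V`
(`ε < t e^{-|χ|}`), where `cos(4iχ) = ch 4χ`. Leans on: tree `Literature.Analysis.Complex.PeriodicEntireFourier`
(rectangle/periodicity idiom), `OSSectorContinuation.eqOn_strip_of_eqOn_real`; Mathlib
`hasDerivAt_integral_of_dominated_loc_of_deriv_le`, `Complex.integral_boundary_rect_eq_zero_of_differentiableOn`,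
`fourierBasis`/`fourierCoeff` on `AddCircle`. -/
theorem stub_angleBandLimit (K : E4 → ℝ) (C a : ℝ) (ha : 0 < a) (ha12 : a < 12)
    (hdecay : ∀ x : E4, x ≠ 0 → |K x| ≤ C * (1 + ‖x‖ ^ (-a)))
    (hrot : ∀ x : E4, K (WithLp.toLp 2 ![-x 1, x 0, x 2, x 3]) = K x)
    (hflip : ∀ x : E4, K (WithLp.toLp 2 ![x 0, -x 1, x 2, x 3]) = K x)
    (μ : ℝ → Measure E4) (hfin : ∀ ε : ℝ, 0 < ε → IsFiniteMeasure (μ ε))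
    (hE : ∀ ε : ℝ, 0 < ε → μ ε {p : E4 | p 0 < 0} = 0)
    (hcone : ∀ ε : ℝ, 0 < ε → μ ε {p : E4 | p 0 < |p 1|} = 0)
    (hrep : ∀ ε : ℝ, 0 < ε → ∀ t : ℝ, 0 ≤ t → ∀ v : E4, v 0 = 0 →
      ((K (EuclideanSpace.single 0 (ε + t) + v) : ℝ) : ℂ) =
        ∫ p, Complex.exp ((((-(t * p 0) : ℝ)) : ℂ) + ((⟪v, p⟫_ℝ : ℝ) : ℂ) * Complex.I) ∂(μ ε)) :
    ∃ b : Fin 3 → ℝ → ℝ → ℝ → ℝ, ∀ t : ℝ, 0 < t → ∀ y z : ℝ,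
      (∀ φ : ℝ, K (WithLp.toLp 2 ![t * Real.cos φ, t * Real.sin φ, y, z]) =
        b 0 t y z + b 1 t y z * Real.cos (4 * φ) + b 2 t y z * Real.cos (8 * φ)) ∧
      (∀ χ ε : ℝ, 0 < ε → ε < t * Real.exp (-|χ|) →
        (((b 0 t y z + b 1 t y z * Real.cosh (4 * χ) + b 2 t y z * Real.cosh (8 * χ) : ℝ)) : ℂ) =
          ∫ p, Complex.exp ((((-((t * Real.cosh χ - ε) * p 0 + t * Real.sinh χ * p 1)) : ℝ) : ℂ) +
            ((y * p 2 + z * p 3 : ℝ) : ℂ) * Complex.I) ∂(μ ε)) := by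
  sorry

/-- **Stub B · the transverse pinch (this line's back end; L).** `K` continuous off `0` with the window
`|K x| ≤ C(1 + ‖x‖^{-a})`, `2 < a < 10`, even in the transverse pair `(x₂,x₃)`; two families of finite
positive measures `μ ε`, `μ' ε` carried by the light cone `{p₀ ≥ |p₁|}`; and two coefficient tables `b`, `b'`
such that for every `t > 0`, `(y,z)`: the AXIS trace `K(t cos φ, t sin φ, y, z) = Σ_j b_j cos(4jφ)` with the
chart identity `Σ_j b_j ch(4jχ) = ∫ exp(-(t ch χ - ε)p₀ - t sh χ p₁ + i(y p₂ + z p₃)) d(μ ε)`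
(`0 < ε < t e^{-|χ|}`), and the DIAGONAL trace `K(t cos(φ - π/4), t sin(φ - π/4), y, z) = Σ_j b'_j cos(4jφ)`
with the same identity for `μ'`. Then `K(t cos φ, t sin φ, y, z) = K(t, 0, y, z)`.
Why true: fix `t`; `c_j(ζ) = b_j(t,ζ)` are Fourier averages of `K` over the circle, hence continuous, even
(`hflip23`) and bounded by `2C(1 + t^{-a})`; comparing the two traces, `b' = (c₀, -c₁, c₂)`. For a bump
`h ≥ 0` on `ℝ²` put `B_j = ∫∫ c_j(w - w') h(w) h(w') dw dw'`; Fubini in the chart identity gives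
`B₀ + B₁ ch 4χ + B₂ ch 8χ = ∫ g_χ |ĥ(p₂,p₃)|² d(μ ε) =: I(χ) ≥ 0` with
`g_χ = exp(-(t ch χ - ε)p₀ - t sh χ p₁) ≤ exp(-(t e^{-|χ|} - ε)p₀)` ON THE CONE, whence (the same identity at
time `s = t e^{-|χ|}`, `χ = 0`) `I(χ) ≤ ∫∫ K(s, 0, w - w') h h ≤ C‖h‖₁² + C‖h‖₁‖h‖_∞ ∫_{ℝ²}(s² + |v|²)^{-a/2} dv
= O(1 + s^{2-a})` — smearing gains the two transverse dimensions. Dividing by `ch 8χ` and `χ → ∞`: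
`0 ≤ B₂ ≤ lim (A₀ + A₁ e^{(a-2)|χ|} + |B₁| ch 4χ)/ch 8χ = 0` (`a - 2 < 8`). So `B₂ = 0` for every bump; bumps
shrinking to `δ₀` give `c₂(0) = 0`; `c₂` is positive-definite (pointwise limit of `P_χ/ch 8χ`,
`P_χ(ζ) = ∫ g_χ e^{i p_⊥·ζ}`), so `|c₂(ζ)| ≤ c₂(0) = 0`. With `c₂ ≡ 0` (all `t`): `B₀ + B₁ ch 4χ = I ≥ 0` and,
from the primed data, `B₀ - B₁ ch 4χ = I' ≥ 0`, so `|B₁| ≤ B₀ / ch 4χ → 0`, `B₁ = 0`, `c₁(0) = 0`, `c₁`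
positive-definite, `c₁ ≡ 0`. Threshold check: `H₈(x) r⁻¹⁸` (`a = 10`) has `B₂ > 0` and `I(χ) ≍ e^{8|χ|}` —
exactly not pinched. Leans on: Mathlib Fubini (`integral_prod`, `Integrable.prod_mul`), Gaussian/box Fourier
transforms or none (`|∫ h e^{ip·w}|²` only), `Measure.integral_comp_smul` (scaling `v = s u` in `ℝ²`),
`integrable_rpow_neg_one_add_norm_sq` (`a > 2 = dim`), dominated convergence, `Real.cosh` asymptotics. -/
theorem stub_transversePinch (K : E4 → ℝ) (C a : ℝ) (ha2 : 2 < a) (ha10 : a < 10)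
    (hcont : ContinuousOn K {x : E4 | x ≠ 0})
    (hdecay : ∀ x : E4, x ≠ 0 → |K x| ≤ C * (1 + ‖x‖ ^ (-a)))
    (hflip23 : ∀ x : E4, K (WithLp.toLp 2 ![x 0, x 1, -x 2, -x 3]) = K x)
    (μ μ' : ℝ → Measure E4)
    (hfin : ∀ ε : ℝ, 0 < ε → IsFiniteMeasure (μ ε))
    (hfin' : ∀ ε : ℝ, 0 < ε → IsFiniteMeasure (μ' ε))
    (hcone : ∀ ε : ℝ, 0 < ε → μ ε {p : E4 | p 0 < |p 1|} = 0)
    (hcone' : ∀ ε : ℝ, 0 < ε → μ' ε {p : E4 | p 0 < |p 1|} = 0)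
    (b b' : Fin 3 → ℝ → ℝ → ℝ → ℝ)
    (hb : ∀ t : ℝ, 0 < t → ∀ y z : ℝ,
      (∀ φ : ℝ, K (WithLp.toLp 2 ![t * Real.cos φ, t * Real.sin φ, y, z]) =
        b 0 t y z + b 1 t y z * Real.cos (4 * φ) + b 2 t y z * Real.cos (8 * φ)) ∧
      (∀ χ ε : ℝ, 0 < ε → ε < t * Real.exp (-|χ|) →
        (((b 0 t y z + b 1 t y z * Real.cosh (4 * χ) + b 2 t y z * Real.cosh (8 * χ) : ℝ)) : ℂ) =
          ∫ p, Complex.exp ((((-((t * Real.cosh χ - ε) * p 0 + t * Real.sinh χ * p 1)) : ℝ) : ℂ) +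
            ((y * p 2 + z * p 3 : ℝ) : ℂ) * Complex.I) ∂(μ ε)))
    (hb' : ∀ t : ℝ, 0 < t → ∀ y z : ℝ,
      (∀ φ : ℝ, K (WithLp.toLp 2 ![t * Real.cos (φ - π / 4), t * Real.sin (φ - π / 4), y, z]) =
        b' 0 t y z + b' 1 t y z * Real.cos (4 * φ) + b' 2 t y z * Real.cos (8 * φ)) ∧
      (∀ χ ε : ℝ, 0 < ε → ε < t * Real.exp (-|χ|) →
        (((b' 0 t y z + b' 1 t y z * Real.cosh (4 * χ) + b' 2 t y z * Real.cosh (8 * χ) : ℝ)) : ℂ) =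
          ∫ p, Complex.exp ((((-((t * Real.cosh χ - ε) * p 0 + t * Real.sinh χ * p 1)) : ℝ) : ℂ) +
            ((y * p 2 + z * p 3 : ℝ) : ℂ) * Complex.I) ∂(μ' ε))) :
    ∀ t : ℝ, 0 < t → ∀ y z φ : ℝ,
      K (WithLp.toLp 2 ![t * Real.cos φ, t * Real.sin φ, y, z]) = K (WithLp.toLp 2 ![t, 0, y, z]) := by
  sorry

/-- **Stub P1 · the smeared chart identity (Fubini; M).** For a finite positive measure `μ` on `ℝ⁴`
carried by the light cone `{p₀ ≥ |p₁|}` and the box `Q = [0,δ]²`, there is a bounded measurable `Φ ≥ 0` on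
`ℝ⁴` (namely `Φ(p) = |∫_Q e^{i(w₁p₂ + w₂p₃)} dw|²`) such that for all `A > |B|` the box-smeared real part of the
chart integral `ζ ↦ ∫ exp(-(A p₀ + B p₁) + i(ζ₁p₂ + ζ₂p₃)) dμ` equals `∫ e^{-(A p₀ + B p₁)} Φ dμ`.
Why true: on the cone `A p₀ + B p₁ ≥ (A - |B|) p₀ ≥ 0`, so the triple integrand is bounded by `1` (`μ` finite,
`Q × Q` compact) and Fubini applies; `∫_Q∫_Q e^{i(w-w')·q} dw dw' = |∫_Q e^{iw·q} dw|²`. Helper for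
`stub_transversePinch`. Leans on: Mathlib `MeasureTheory.integral_prod`, `integral_integral_swap`,
`Complex.exp_add`, `setIntegral_prod`. -/
theorem stub_smearedChartIdentity (μ : Measure E4) [IsFiniteMeasure μ]
    (hcone : μ {p : E4 | p 0 < |p 1|} = 0) (δ : ℝ) (hδ : 0 < δ) :
    ∃ Φ : E4 → ℝ, Measurable Φ ∧ (∀ p, 0 ≤ Φ p) ∧ (∃ M : ℝ, ∀ p, Φ p ≤ M) ∧
      ∀ A B : ℝ, |B| < A →
        Integrable (fun p : E4 => Real.exp (-(A * p 0 + B * p 1)) * Φ p) μ ∧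
        ∫ w in Set.Icc (0 : ℝ) δ ×ˢ Set.Icc (0 : ℝ) δ, ∫ w' in Set.Icc (0 : ℝ) δ ×ˢ Set.Icc (0 : ℝ) δ,
            (∫ p, Complex.exp ((((-(A * p 0 + B * p 1)) : ℝ) : ℂ) +
              (((w.1 - w'.1) * p 2 + (w.2 - w'.2) * p 3 : ℝ) : ℂ) * Complex.I) ∂μ).re
          = ∫ p, Real.exp (-(A * p 0 + B * p 1)) * Φ p ∂μ := by
  sorry

/-- **Stub P2 · the transverse smearing bound (M).** `K` continuous off `0` with `|K x| ≤ C(1 + ‖x‖^{-a})`,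
`a > 2`: the box-smeared transverse trace at time `s > 0` is `O(1 + s^{2-a})` uniformly in `s`:
`∫_Q∫_Q K(s, 0, w - w') dw dw' ≤ C δ⁴ + C δ² ∫_{ℝ²} (s² + |v|²)^{-a/2} dv = C δ⁴ + C δ² c_a s^{2-a}`
(`c_a = ∫_{ℝ²}(1 + |u|²)^{-a/2} du = 2π/(a-2)`, scaling `v = s u`) — the smearing gains the two transverse
dimensions. Helper for `stub_transversePinch`. Leans on: Mathlib `integrable_rpow_neg_one_add_norm_sq` /
`finite_integral_one_add_norm` (`a > 2 = dim`), `Measure.integral_comp_smul`, `norm_setIntegral_le_of_norm_le_const`. -/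
theorem stub_transverseSmearBound (K : E4 → ℝ) (C a : ℝ) (ha2 : 2 < a)
    (hcont : ContinuousOn K {x : E4 | x ≠ 0})
    (hdecay : ∀ x : E4, x ≠ 0 → |K x| ≤ C * (1 + ‖x‖ ^ (-a)))
    (δ : ℝ) (hδ : 0 < δ) :
    ∃ C' : ℝ, ∀ s : ℝ, 0 < s →
      ∫ w in Set.Icc (0 : ℝ) δ ×ˢ Set.Icc (0 : ℝ) δ, ∫ w' in Set.Icc (0 : ℝ) δ ×ˢ Set.Icc (0 : ℝ) δ,
          K (WithLp.toLp 2 ![s, 0, w.1 - w'.1, w.2 - w'.2]) ≤ C' * (1 + s ^ (2 - a)) := by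
  sorry

/-- **Stub P3 · box means shrinking to the origin (approximate identity; S/M).** A continuous function on
`ℝ²` all of whose double box means `∫_{[0,δ]²}∫_{[0,δ]²} c(w - w') dw dw'` (`0 < δ < 1`) vanish has `c(0) = 0`:
`|∫∫ c(w-w') - δ⁴ c(0)| ≤ δ⁴ sup_{|v|_∞ ≤ δ} |c(v) - c(0)| = o(δ⁴)`. Helper for `stub_transversePinch`. -/
theorem stub_boxMeanVanish (c : ℝ × ℝ → ℝ) (hc : Continuous c)
    (hzero : ∀ δ : ℝ, 0 < δ → δ < 1 →
      ∫ w in Set.Icc (0 : ℝ) δ ×ˢ Set.Icc (0 : ℝ) δ, ∫ w' in Set.Icc (0 : ℝ) δ ×ˢ Set.Icc (0 : ℝ) δ,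
        c (w.1 - w'.1, w.2 - w'.2) = 0) :
    c 0 = 0 := by
  sorry

/-! ## Glue I — signed permutations, the 45° rotation, coordinates -/

/-- `K` is invariant under the signed permutation `(σ, s)`. [bookkeeping] -/
theorem K_signedPerm {K : E4 → ℝ}
    (hW : ∀ R : E4 ≃ₗᵢ[ℝ] E4, (∀ i : Fin 4, ∃ j : Fin 4,
        R (EuclideanSpace.single i 1) = EuclideanSpace.single j 1 ∨
        R (EuclideanSpace.single i 1) = -EuclideanSpace.single j 1) → ∀ x : E4, K (R x) = K x)
    (σ : Equiv.Perm (Fin 4)) (s : Fin 4 → ℤˣ) (x : E4) :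
    K (signedPermIsometry σ s x) = K x :=
  hW _ (isSignedPermIsometry_signedPermIsometry σ s) x

/-- A vector of `ℝ⁴` given by its four coordinates. [bookkeeping] -/
theorem eq_mk4 (x : E4) : x = WithLp.toLp 2 ![x 0, x 1, x 2, x 3] := by
  ext i; fin_cases i <;> rfl

@[simp] theorem mk4_apply_zero (a b c d : ℝ) : (WithLp.toLp 2 ![a, b, c, d] : E4) 0 = a := rfl
@[simp] theorem mk4_apply_one (a b c d : ℝ) : (WithLp.toLp 2 ![a, b, c, d] : E4) 1 = b := rfl
@[simp] theorem mk4_apply_two (a b c d : ℝ) : (WithLp.toLp 2 ![a, b, c, d] : E4) 2 = c := rfl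
@[simp] theorem mk4_apply_three (a b c d : ℝ) : (WithLp.toLp 2 ![a, b, c, d] : E4) 3 = d := rfl

/-- Invariance of `K` under an explicitly given signed permutation, coordinate form: if
`y j = s j * x (σ j)` for all `j` then `K y = K x`. [bookkeeping] -/
theorem K_of_coords {K : E4 → ℝ}
    (hW : ∀ R : E4 ≃ₗᵢ[ℝ] E4, (∀ i : Fin 4, ∃ j : Fin 4,
        R (EuclideanSpace.single i 1) = EuclideanSpace.single j 1 ∨
        R (EuclideanSpace.single i 1) = -EuclideanSpace.single j 1) → ∀ x : E4, K (R x) = K x)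
    (σ : Equiv.Perm (Fin 4)) (s : Fin 4 → ℤˣ) (x y : E4)
    (h : ∀ j : Fin 4, y j = ((s j : ℤ) : ℝ) * x (σ j)) : K y = K x := by
  have : y = signedPermIsometry σ s x := by
    ext j; rw [signedPermIsometry_apply]; exact h j
  rw [this, K_signedPerm hW]

/-- The norm of a vector of `ℝ⁴` in coordinates. [bookkeeping] -/
theorem norm_mk4 (a b c d : ℝ) :
    ‖(WithLp.toLp 2 ![a, b, c, d] : E4)‖ = Real.sqrt (a ^ 2 + b ^ 2 + c ^ 2 + d ^ 2) := by
  rw [EuclideanSpace.norm_eq, Fin.sum_univ_four]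
  simp [sq_abs]

/-- The norm of a vector of `ℝ⁴` in its own coordinates. [bookkeeping] -/
theorem norm_eq_sqrt4 (x : E4) : ‖x‖ = Real.sqrt (x 0 ^ 2 + x 1 ^ 2 + x 2 ^ 2 + x 3 ^ 2) := by
  conv_lhs => rw [eq_mk4 x]
  exact norm_mk4 _ _ _ _

/-- The 45° rotation `R₋₄₅ (x₀,x₁,x₂,x₃) = ((x₀+x₁)/√2, (x₁-x₀)/√2, x₂, x₃)` preserves the norm. [bookkeeping] -/
theorem norm_rot45 (x : E4) :
    ‖(WithLp.toLp 2 ![(x 0 + x 1) / Real.sqrt 2, (x 1 - x 0) / Real.sqrt 2, x 2, x 3] : E4)‖ = ‖x‖ := by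
  rw [norm_mk4, norm_eq_sqrt4]
  congr 1
  have h2 : Real.sqrt 2 ^ 2 = 2 := Real.sq_sqrt (by norm_num)
  field_simp
  rw [h2]; ring

/-- The 45° rotation is continuous. [bookkeeping] -/
theorem continuous_rot45 :
    Continuous fun x : E4 =>
      (WithLp.toLp 2 ![(x 0 + x 1) / Real.sqrt 2, (x 1 - x 0) / Real.sqrt 2, x 2, x 3] : E4) := by
  have h : ∀ i : Fin 4, Continuous fun x : E4 => x i := fun i => (PiLp.continuous_apply 2 _ i)
  refine (PiLp.continuous_toLp 2 _).comp ?_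
  refine continuous_pi fun i => ?_
  fin_cases i <;> simp <;> fun_prop

/-! ## Glue II — the rotated kernel `K' = K ∘ R₋₄₅` satisfies the axis-frame hypotheses -/

section Rotated

variable {K : E4 → ℝ}
  (hW : ∀ R : E4 ≃ₗᵢ[ℝ] E4, (∀ i : Fin 4, ∃ j : Fin 4,
      R (EuclideanSpace.single i 1) = EuclideanSpace.single j 1 ∨
      R (EuclideanSpace.single i 1) = -EuclideanSpace.single j 1) → ∀ x : E4, K (R x) = K x)

include hW in
/-- `θ`-invariance in the hypothesis form of `stub_axisLaplace`. [bookkeeping] -/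
theorem hθ_of_hW : ∀ x y : E4, y 0 = -x 0 → y 1 = x 1 → y 2 = x 2 → y 3 = x 3 → K y = K x := by
  intro x y h0 h1 h2 h3
  refine K_of_coords hW 1 (![(-1 : ℤˣ), 1, 1, 1]) x y fun j => ?_
  fin_cases j <;> simp [h0, h1, h2, h3]

include hW in
/-- Spatial parity in the hypothesis form of `stub_axisLaplace`. [bookkeeping] -/
theorem hP_of_hW : ∀ x y : E4, y 0 = x 0 → y 1 = -x 1 → y 2 = -x 2 → y 3 = -x 3 → K y = K x := by
  intro x y h0 h1 h2 h3
  refine K_of_coords hW 1 (![(1 : ℤˣ), -1, -1, -1]) x y fun j => ?_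
  fin_cases j <;> simp [h0, h1, h2, h3]

include hW in
/-- `R_{π/2}`-invariance: `K(-x₁, x₀, x₂, x₃) = K x`. [bookkeeping] -/
theorem hrot_of_hW : ∀ x : E4, K (WithLp.toLp 2 ![-x 1, x 0, x 2, x 3]) = K x := by
  intro x
  refine K_of_coords hW (Equiv.swap 0 1) (![(-1 : ℤˣ), 1, 1, 1]) x _ fun j => ?_
  fin_cases j <;> simp [Equiv.swap_apply_def]

include hW in
/-- `x₁ ↦ -x₁`: `K(x₀, -x₁, x₂, x₃) = K x`. [bookkeeping] -/
theorem hflip1_of_hW : ∀ x : E4, K (WithLp.toLp 2 ![x 0, -x 1, x 2, x 3]) = K x := by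
  intro x
  refine K_of_coords hW 1 (![(1 : ℤˣ), -1, 1, 1]) x _ fun j => ?_
  fin_cases j <;> simp

include hW in
/-- `(x₂,x₃) ↦ (-x₂,-x₃)`: `K(x₀, x₁, -x₂, -x₃) = K x`. [bookkeeping] -/
theorem hflip23_of_hW : ∀ x : E4, K (WithLp.toLp 2 ![x 0, x 1, -x 2, -x 3]) = K x := by
  intro x
  refine K_of_coords hW 1 (![(1 : ℤˣ), 1, -1, -1]) x _ fun j => ?_
  fin_cases j <;> simp

include hW in
/-- swap of `0,1`: `K(x₁, x₀, x₂, x₃) = K x`. [bookkeeping] -/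
theorem hswap01_of_hW : ∀ x : E4, K (WithLp.toLp 2 ![x 1, x 0, x 2, x 3]) = K x := by
  intro x
  refine K_of_coords hW (Equiv.swap 0 1) (![(1 : ℤˣ), 1, 1, 1]) x _ fun j => ?_
  fin_cases j <;> simp [Equiv.swap_apply_def]

include hW in
/-- `(x₀,x₁) ↦ (-x₁,-x₀)` with `(x₂,x₃) ↦ (-x₂,-x₃)`. [bookkeeping] -/
theorem hnegswapP_of_hW : ∀ x : E4, K (WithLp.toLp 2 ![-x 1, -x 0, -x 2, -x 3]) = K x := by
  intro x
  refine K_of_coords hW (Equiv.swap 0 1) (![(-1 : ℤˣ), -1, -1, -1]) x _ fun j => ?_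
  fin_cases j <;> simp [Equiv.swap_apply_def]

include hW in
/-- `(x₀,x₁) ↦ (-x₁,-x₀)`. [bookkeeping] -/
theorem hnegswap_of_hW : ∀ x : E4, K (WithLp.toLp 2 ![-x 1, -x 0, x 2, x 3]) = K x := by
  intro x
  refine K_of_coords hW (Equiv.swap 0 1) (![(-1 : ℤˣ), -1, 1, 1]) x _ fun j => ?_
  fin_cases j <;> simp [Equiv.swap_apply_def]

end Rotated


/-! ## Glue III — small analytic facts -/

/-- Polar form of a planar vector of radius `r > 0`. [bookkeeping] -/
theorem exists_polar {p q r : ℝ} (hr : 0 < r) (h : p ^ 2 + q ^ 2 = r ^ 2) :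
    ∃ φ : ℝ, p = r * Real.cos φ ∧ q = r * Real.sin φ := by
  set w : ℂ := ⟨p, q⟩ with hw
  have hnorm : ‖w‖ = r := by
    rw [Complex.norm_def, Complex.normSq_mk, ← sq, ← sq, h]
    exact Real.sqrt_sq hr.le
  have hw0 : w ≠ 0 := by
    intro h0; rw [h0, norm_zero] at hnorm; linarith
  refine ⟨Complex.arg w, ?_, ?_⟩
  · have := Complex.cos_arg hw0
    rw [hnorm] at this
    field_simp at this
    simpa [hw, mul_comm] using this.symm
  · have := Complex.sin_arg w
    rw [hnorm] at this
    field_simp at this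
    simpa [hw, mul_comm] using this.symm

/-- `⟪single 1 b, p⟫ = b * p 1`. [bookkeeping] -/
theorem inner_single_one (b : ℝ) (p : E4) :
    ⟪(EuclideanSpace.single 1 b : E4), p⟫_ℝ = b * p 1 := by
  rw [EuclideanSpace.inner_single_left]; simp

/-- The swap of the coordinates `0, 1` in coordinates. [bookkeeping] -/
theorem swap01_apply (u : E4) (k : Fin 4) :
    LinearIsometryEquiv.piLpCongrLeft 2 ℝ ℝ (Equiv.swap (0 : Fin 4) 1) u k = u (Equiv.swap (0 : Fin 4) 1 k) := by
  fin_cases k <;> simp [LinearIsometryEquiv.piLpCongrLeft_apply, Equiv.swap_apply_def]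

/-- Uniqueness of the coefficients of `1, cos 4φ, cos 8φ`. [bookkeeping] -/
theorem trig_coeff_unique {a₀ a₁ a₂ c₀ c₁ c₂ : ℝ}
    (h : ∀ φ : ℝ, a₀ + a₁ * Real.cos (4 * φ) + a₂ * Real.cos (8 * φ) =
      c₀ + c₁ * Real.cos (4 * φ) + c₂ * Real.cos (8 * φ)) :
    a₀ = c₀ ∧ a₁ = c₁ ∧ a₂ = c₂ := by
  have h0 := h 0
  have h1 := h (π / 8)
  have h2 := h (π / 4)
  have e1 : Real.cos (4 * (π / 8)) = 0 := by rw [show 4 * (π / 8) = π / 2 by ring]; exact Real.cos_pi_div_two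
  have e2 : Real.cos (8 * (π / 8)) = -1 := by rw [show 8 * (π / 8) = π by ring]; exact Real.cos_pi
  have e3 : Real.cos (4 * (π / 4)) = -1 := by rw [show 4 * (π / 4) = π by ring]; exact Real.cos_pi
  have e4 : Real.cos (8 * (π / 4)) = 1 := by
    rw [show 8 * (π / 4) = (2 : ℕ) * π by push_cast; ring]; exact Real.cos_nat_mul_pi 2 |>.trans (by norm_num)
  simp only [mul_zero, Real.cos_zero, mul_one] at h0
  rw [e1, e2] at h1
  rw [e3, e4] at h2
  refine ⟨by linarith, by linarith, by linarith⟩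

/-! ## Glue IV — the composition: the four stubs prove the crux BY NAME -/

/-- **The crux `PencilRigidity.ShellRigidity` from the four registered stubs** (and the landed front end of
line `transverse-smearing-planar-threshold`). -/
theorem ShellRigidity_of : ShellRigidity := by
  intro K hcont hbd hW h4 h5
  ------------------------------------------------------------------
  -- Reduction: planar rotation invariance at every transverse offset suffices (norm reduction).
  ------------------------------------------------------------------
  suffices hplanar : ∀ t : ℝ, 0 < t → ∀ y z φ : ℝ,
      K (WithLp.toLp 2 ![t * Real.cos φ, t * Real.sin φ, y, z]) = K (WithLp.toLp 2 ![t, 0, y, z]) by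
    have hswap12 : ∀ a b c d : ℝ,
        K (WithLp.toLp 2 ![a, c, b, d]) = K (WithLp.toLp 2 ![a, b, c, d]) := by
      intro a b c d
      refine K_of_coords hW (Equiv.swap 1 2) (![(1 : ℤˣ), 1, 1, 1]) _ _ fun j => ?_
      fin_cases j <;> simp [Equiv.swap_apply_def]
    have hswap13 : ∀ a b c d : ℝ,
        K (WithLp.toLp 2 ![a, d, c, b]) = K (WithLp.toLp 2 ![a, b, c, d]) := by
      intro a b c d
      refine K_of_coords hW (Equiv.swap 1 3) (![(1 : ℤˣ), 1, 1, 1]) _ _ fun j => ?_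
      fin_cases j <;> simp [Equiv.swap_apply_def]
    have planar : ∀ x y : ℝ × ℝ, x ≠ 0 → x.1 ^ 2 + x.2 ^ 2 = y.1 ^ 2 + y.2 ^ 2 → ∀ z : ℝ × ℝ,
        K (WithLp.toLp 2 ![y.1, y.2, z.1, z.2]) = K (WithLp.toLp 2 ![x.1, x.2, z.1, z.2]) := by
      intro x y hx hxy z
      set r : ℝ := Real.sqrt (x.1 ^ 2 + x.2 ^ 2) with hr_def
      have hpos : 0 < x.1 ^ 2 + x.2 ^ 2 := by
        rcases x with ⟨x1, x2⟩
        by_contra hle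
        have h1 : x1 = 0 := by nlinarith [sq_nonneg x1, sq_nonneg x2]
        have h2 : x2 = 0 := by nlinarith [sq_nonneg x1, sq_nonneg x2]
        exact hx (by simp [h1, h2])
      have hr : 0 < r := Real.sqrt_pos.2 hpos
      have hr2 : r ^ 2 = x.1 ^ 2 + x.2 ^ 2 := Real.sq_sqrt hpos.le
      have key : ∀ p q : ℝ, p ^ 2 + q ^ 2 = x.1 ^ 2 + x.2 ^ 2 →
          K (WithLp.toLp 2 ![p, q, z.1, z.2]) = K (WithLp.toLp 2 ![r, 0, z.1, z.2]) := by
        intro p q hpq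
        obtain ⟨φ, hp, hq⟩ := exists_polar hr (hpq.trans hr2.symm)
        rw [hp, hq]
        exact hplanar r hr z.1 z.2 φ
      rw [key y.1 y.2 hxy.symm, key x.1 x.2 rfl]
    intro R x _hx
    rw [RadialLift.norm_reduction K hswap12 hswap13 planar (R x),
      RadialLift.norm_reduction K hswap12 hswap13 planar x, LinearIsometryEquiv.norm_map]
  ------------------------------------------------------------------
  -- (0) exponent reduction: the decay window `a = 10 - min η 7 ∈ [3, 10)`
  ------------------------------------------------------------------
  obtain ⟨C₀, η, hη, hb₀⟩ := hbd
  obtain ⟨C, hC⟩ := stub_exponentReduction K η hη hcont ⟨C₀, hb₀⟩ hW h4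
  set a : ℝ := 10 - min η 7 with ha_def
  have ha3 : 3 ≤ a := by have := min_le_right η 7; linarith
  have ha10 : a < 10 := by have : 0 < min η 7 := lt_min hη (by norm_num); linarith
  have hdecay : ∀ x : E4, x ≠ 0 → |K x| ≤ C * (1 + ‖x‖ ^ (-a)) := by
    intro x hx
    have := hC x hx
    rwa [show min η 7 - 10 = -a by rw [ha_def]; ring] at this
  ------------------------------------------------------------------
  -- (1) symmetries of `K` from `W(B₄)`
  ------------------------------------------------------------------
  have hθK := hθ_of_hW hW
  have hPK := hP_of_hW hW
  have hrotK := hrot_of_hW hW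
  have hflip1K := hflip1_of_hW hW
  have hflip23K := hflip23_of_hW hW
  have hswapK := hswap01_of_hW hW
  have hnegswapPK := hnegswapP_of_hW hW
  have hnegswapK := hnegswap_of_hW hW
  ------------------------------------------------------------------
  -- (2) the rotated kernel `K' = K ∘ R₋₄₅` and its axis-frame hypotheses
  ------------------------------------------------------------------
  set K' : E4 → ℝ := fun x =>
    K (WithLp.toLp 2 ![(x 0 + x 1) / Real.sqrt 2, (x 1 - x 0) / Real.sqrt 2, x 2, x 3]) with hK'_def
  have hs2 : 0 < Real.sqrt 2 := Real.sqrt_pos.2 two_pos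
  have hs2' : Real.sqrt 2 ≠ 0 := hs2.ne'
  have hss : Real.sqrt 2 * Real.sqrt 2 = 2 := Real.mul_self_sqrt two_pos.le
  have hsq : Real.sqrt 2 ^ 2 = 2 := Real.sq_sqrt two_pos.le
  have rot_ne : ∀ x : E4, x ≠ 0 →
      (WithLp.toLp 2 ![(x 0 + x 1) / Real.sqrt 2, (x 1 - x 0) / Real.sqrt 2, x 2, x 3] : E4) ≠ 0 := by
    intro x hx h0
    apply hx
    have := norm_rot45 x
    rw [h0, norm_zero] at this
    exact norm_eq_zero.1 this.symm
  have hcont' : ContinuousOn K' {x : E4 | x ≠ 0} :=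
    hcont.comp continuous_rot45.continuousOn fun x hx => rot_ne x hx
  have hdecay' : ∀ x : E4, x ≠ 0 → |K' x| ≤ C * (1 + ‖x‖ ^ (-a)) := by
    intro x hx
    have := hdecay _ (rot_ne x hx)
    rwa [norm_rot45] at this
  -- symmetries of `K'`
  have hθ' : ∀ x y : E4, y 0 = -x 0 → y 1 = x 1 → y 2 = x 2 → y 3 = x 3 → K' y = K' x := by
    intro x y h0 h1 h2 h3
    simp only [hK'_def]
    rw [← hswapK (WithLp.toLp 2 ![(x 0 + x 1) / Real.sqrt 2, (x 1 - x 0) / Real.sqrt 2, x 2, x 3])]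
    congr 1; ext i; fin_cases i <;> simp [h0, h1, h2, h3] <;> ring
  have hP' : ∀ x y : E4, y 0 = x 0 → y 1 = -x 1 → y 2 = -x 2 → y 3 = -x 3 → K' y = K' x := by
    intro x y h0 h1 h2 h3
    simp only [hK'_def]
    rw [← hnegswapPK (WithLp.toLp 2 ![(x 0 + x 1) / Real.sqrt 2, (x 1 - x 0) / Real.sqrt 2, x 2, x 3])]
    congr 1; ext i; fin_cases i <;> simp [h0, h1, h2, h3] <;> ring
  have hrot' : ∀ x : E4, K' (WithLp.toLp 2 ![-x 1, x 0, x 2, x 3]) = K' x := by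
    intro x
    simp only [hK'_def]
    rw [← hrotK (WithLp.toLp 2 ![(x 0 + x 1) / Real.sqrt 2, (x 1 - x 0) / Real.sqrt 2, x 2, x 3])]
    congr 1; ext i; fin_cases i <;> simp <;> ring
  have hflip1' : ∀ x : E4, K' (WithLp.toLp 2 ![x 0, -x 1, x 2, x 3]) = K' x := by
    intro x
    simp only [hK'_def]
    rw [← hnegswapK (WithLp.toLp 2 ![(x 0 + x 1) / Real.sqrt 2, (x 1 - x 0) / Real.sqrt 2, x 2, x 3])]
    congr 1; ext i; fin_cases i <;> simp <;> ring
  have hflip23' : ∀ x : E4, K' (WithLp.toLp 2 ![x 0, x 1, -x 2, -x 3]) = K' x := by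
    intro x
    simp only [hK'_def]
    rw [← hflip23K (WithLp.toLp 2 ![(x 0 + x 1) / Real.sqrt 2, (x 1 - x 0) / Real.sqrt 2, x 2, x 3])]
    congr 1
  -- the crux's DIAGONAL clause is the axis clause of `K'`
  have h4' : ∀ (m : ℕ) (x : Fin m → E4) (c : Fin m → ℝ), (∀ i, 0 < x i 0) →
      0 ≤ ∑ i, ∑ j, c i * c j * K' (timeReflection 4 (x i) - x j) := by
    intro m x c hx
    have key : ∀ i j, K' (timeReflection 4 (x i) - x j) =
        K (LinearIsometryEquiv.piLpCongrLeft 2 ℝ ℝ (Equiv.swap (0 : Fin 4) 1)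
            (WithLp.toLp 2 ![(x i 0 + x i 1) / Real.sqrt 2, (x i 1 - x i 0) / Real.sqrt 2, x i 2, x i 3]) -
          WithLp.toLp 2 ![(x j 0 + x j 1) / Real.sqrt 2, (x j 1 - x j 0) / Real.sqrt 2, x j 2, x j 3]) := by
      intro i j
      simp only [hK'_def]
      congr 1; ext k
      fin_cases k <;> simp [swap01_apply, timeReflection_apply, Equiv.swap_apply_def] <;> ring
    simp_rw [key]
    refine h5 m (fun i => WithLp.toLp 2
      ![(x i 0 + x i 1) / Real.sqrt 2, (x i 1 - x i 0) / Real.sqrt 2, x i 2, x i 3]) c fun i => ?_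
    show (x i 1 - x i 0) / Real.sqrt 2 < (x i 0 + x i 1) / Real.sqrt 2
    rw [div_lt_div_iff_of_pos_right hs2]
    linarith [hx i]
  ------------------------------------------------------------------
  -- (3) boundedness off slabs, then the two axis Laplace families `μ`, `μ'`
  ------------------------------------------------------------------
  have slab : ∀ (L : E4 → ℝ), (∀ x : E4, x ≠ 0 → |L x| ≤ C * (1 + ‖x‖ ^ (-a))) →
      ∀ ε : ℝ, 0 < ε → ∃ B : ℝ, ∀ x : E4, ε ≤ |x 0| → |L x| ≤ B := by
    intro L hL ε hε
    have hC0 : 0 ≤ C := by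
      have h := hdecay (EuclideanSpace.single 0 1) (by simp)
      have h1 : ‖(EuclideanSpace.single (0 : Fin 4) (1 : ℝ) : E4)‖ = 1 := by simp
      rw [h1, Real.one_rpow] at h
      linarith [abs_nonneg (K (EuclideanSpace.single 0 1))]
    refine ⟨C * (1 + ε ^ (-a)), fun x hx => ?_⟩
    have hεx : ε ≤ ‖x‖ := hx.trans (by simpa using PiLp.norm_apply_le x 0)
    have hx0 : x ≠ 0 := by
      intro h0; rw [h0, norm_zero] at hεx; linarith
    calc |L x| ≤ C * (1 + ‖x‖ ^ (-a)) := hL x hx0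
      _ ≤ C * (1 + ε ^ (-a)) := by
        have h1 : ‖x‖ ^ (-a) ≤ ε ^ (-a) := Real.rpow_le_rpow_of_nonpos hε hεx (by linarith)
        have h2 : 1 + ‖x‖ ^ (-a) ≤ 1 + ε ^ (-a) := by linarith
        exact mul_le_mul_of_nonneg_left h2 hC0
  have hbddK := slab K hdecay
  have hbddK' := slab K' hdecay'
  -- the axis family of `K`
  have hLK := stub_axisLaplace K hcont hbddK hθK hPK h4
  have hLK' := stub_axisLaplace K' hcont' hbddK' hθ' hP' h4'
  classical
  -- turn `∀ ε > 0, ∃ μ` into functions `ℝ → Measure E4`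
  choose μd hμd using hLK
  choose μd' hμd' using hLK'
  let μ : ℝ → Measure E4 := fun ε => if h : 0 < ε then μd ε h else 0
  let μ' : ℝ → Measure E4 := fun ε => if h : 0 < ε then μd' ε h else 0
  have hμ : ∀ (ε : ℝ) (h : 0 < ε), μ ε = μd ε h := fun ε h => dif_pos h
  have hμ' : ∀ (ε : ℝ) (h : 0 < ε), μ' ε = μd' ε h := fun ε h => dif_pos h
  have hfin : ∀ ε : ℝ, 0 < ε → IsFiniteMeasure (μ ε) := fun ε h => by rw [hμ ε h]; exact (hμd ε h).1
  have hfin' : ∀ ε : ℝ, 0 < ε → IsFiniteMeasure (μ' ε) := fun ε h => by rw [hμ' ε h]; exact (hμd' ε h).1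
  have hE : ∀ ε : ℝ, 0 < ε → μ ε {p : E4 | p 0 < 0} = 0 := fun ε h => by rw [hμ ε h]; exact (hμd ε h).2.1
  have hE' : ∀ ε : ℝ, 0 < ε → μ' ε {p : E4 | p 0 < 0} = 0 := fun ε h => by
    rw [hμ' ε h]; exact (hμd' ε h).2.1
  have hrep : ∀ ε : ℝ, 0 < ε → ∀ t : ℝ, 0 ≤ t → ∀ v : E4, v 0 = 0 →
      ((K (EuclideanSpace.single 0 (ε + t) + v) : ℝ) : ℂ) =
        ∫ p, Complex.exp ((((-(t * p 0) : ℝ)) : ℂ) + ((⟪v, p⟫_ℝ : ℝ) : ℂ) * Complex.I) ∂(μ ε) :=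
    fun ε h t ht v hv => by rw [hμ ε h]; exact (hμd ε h).2.2 t ht v hv
  have hrep' : ∀ ε : ℝ, 0 < ε → ∀ t : ℝ, 0 ≤ t → ∀ v : E4, v 0 = 0 →
      ((K' (EuclideanSpace.single 0 (ε + t) + v) : ℝ) : ℂ) =
        ∫ p, Complex.exp ((((-(t * p 0) : ℝ)) : ℂ) + ((⟪v, p⟫_ℝ : ℝ) : ℂ) * Complex.I) ∂(μ' ε) :=
    fun ε h t ht v hv => by rw [hμ' ε h]; exact (hμd' ε h).2.2 t ht v hv
  -- planar points in the two frames
  have ptK : ∀ s b : ℝ, (EuclideanSpace.single 0 s + EuclideanSpace.single 1 b : E4) =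
      WithLp.toLp 2 ![s, b, 0, 0] := by
    intro s b; ext i; fin_cases i <;> simp
  have repK : ∀ ε : ℝ, 0 < ε → ∀ t : ℝ, 0 ≤ t → ∀ b : ℝ,
      ((K (WithLp.toLp 2 ![ε + t, b, 0, 0]) : ℝ) : ℂ) =
        ∫ p, Complex.exp ((((-(t * p 0) : ℝ)) : ℂ) + ((b * p 1 : ℝ) : ℂ) * Complex.I) ∂(μ ε) := by
    intro ε hε t ht b
    rw [← ptK, hrep ε hε t ht (EuclideanSpace.single 1 b) (by simp)]
    simp_rw [inner_single_one]
  have repK' : ∀ ε : ℝ, 0 < ε → ∀ t : ℝ, 0 ≤ t → ∀ b : ℝ,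
      ((K' (WithLp.toLp 2 ![ε + t, b, 0, 0]) : ℝ) : ℂ) =
        ∫ p, Complex.exp ((((-(t * p 0) : ℝ)) : ℂ) + ((b * p 1 : ℝ) : ℂ) * Complex.I) ∂(μ' ε) := by
    intro ε hε t ht b
    rw [← ptK, hrep' ε hε t ht (EuclideanSpace.single 1 b) (by simp)]
    simp_rw [inner_single_one]
  ------------------------------------------------------------------
  -- (4) Thales disc sections of the planar traces, and the exact light cones
  ------------------------------------------------------------------
  -- the planar trace of `K` and of `K'`
  set F : ℝ × ℝ → ℝ := fun q => K (WithLp.toLp 2 ![q.1, q.2, 0, 0]) with hF_def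
  set F' : ℝ × ℝ → ℝ := fun q => K' (WithLp.toLp 2 ![q.1, q.2, 0, 0]) with hF'_def
  have planar_ne : ∀ q : ℝ × ℝ, q ≠ 0 → (WithLp.toLp 2 ![q.1, q.2, 0, 0] : E4) ≠ 0 := by
    intro q hq h0
    apply hq
    have h1 := congrArg (fun v : E4 => v 0) h0
    have h2 := congrArg (fun v : E4 => v 1) h0
    simp at h1 h2
    exact Prod.ext h1 h2
  have contF : ∀ (L : E4 → ℝ), ContinuousOn L {x : E4 | x ≠ 0} →
      ContinuousOn (fun q : ℝ × ℝ => L (WithLp.toLp 2 ![q.1, q.2, 0, 0])) {q | q ≠ 0} := by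
    intro L hL
    have hφ : Continuous fun q : ℝ × ℝ => (WithLp.toLp 2 ![q.1, q.2, 0, 0] : E4) := by
      refine (PiLp.continuous_toLp 2 _).comp (continuous_pi fun i => ?_)
      fin_cases i <;> simp <;> fun_prop
    exact hL.comp hφ.continuousOn fun q hq => planar_ne q hq
  have symF : ∀ t s : ℝ, F (t, s) = F (s, t) ∧ F (t, s) = F (t, -s) ∧ F (t, s) = F (-t, s) := by
    intro t s
    refine ⟨?_, ?_, ?_⟩
    · simp only [hF_def]; rw [← hswapK]; rfl
    · simp only [hF_def]; rw [← hflip1K]; simp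
    · simp only [hF_def]
      rw [← hθK (WithLp.toLp 2 ![-t, s, 0, 0]) (WithLp.toLp 2 ![t, s, 0, 0]) (by simp) rfl rfl rfl]
  have symF' : ∀ t s : ℝ, F' (t, s) = F' (s, t) ∧ F' (t, s) = F' (t, -s) ∧ F' (t, s) = F' (-t, s) := by
    intro t s
    have hswapK' : ∀ x : E4, K' (WithLp.toLp 2 ![x 1, x 0, x 2, x 3]) = K' x := by
      intro x
      simp only [hK'_def]
      rw [← hflip1K (WithLp.toLp 2 ![(x 0 + x 1) / Real.sqrt 2, (x 1 - x 0) / Real.sqrt 2, x 2, x 3])]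
      congr 1; ext i; fin_cases i <;> simp <;> ring
    refine ⟨?_, ?_, ?_⟩
    · simp only [hF'_def]; rw [← hswapK']; rfl
    · simp only [hF'_def]; rw [← hflip1']; simp
    · simp only [hF'_def]
      rw [← hθ' (WithLp.toLp 2 ![-t, s, 0, 0]) (WithLp.toLp 2 ![t, s, 0, 0]) (by simp) rfl rfl rfl]
  -- the diagonal-frame representation of `F` is the axis family of `K'`, and vice versa
  have diagF : ∀ ε : ℝ, 0 < ε → ∃ ν : Measure E4, IsFiniteMeasure ν ∧ ν {p | p 0 < 0} = 0 ∧
      ∀ u : ℝ, 0 ≤ u → ∀ v : ℝ,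
        ((F ((ε + u + v) / Real.sqrt 2, (ε + u - v) / Real.sqrt 2) : ℝ) : ℂ) =
          ∫ p, cexp ((((-(u * p 0) : ℝ)) : ℂ) + ((v * p 1 : ℝ) : ℂ) * I) ∂ν := by
    intro ε hε
    refine ⟨μ' ε, hfin' ε hε, hE' ε hε, fun u hu v => ?_⟩
    rw [← repK' ε hε u hu v]
    simp only [hF_def, hK'_def, mk4_apply_zero, mk4_apply_one, mk4_apply_two, mk4_apply_three]
    rw [← hflip1K (WithLp.toLp 2 ![(ε + u + v) / Real.sqrt 2, (ε + u - v) / Real.sqrt 2, 0, 0])]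
    congr 2; ext i; fin_cases i <;> simp <;> field_simp <;> (try rw [hsq]) <;> ring
  have diagF' : ∀ ε : ℝ, 0 < ε → ∃ ν : Measure E4, IsFiniteMeasure ν ∧ ν {p | p 0 < 0} = 0 ∧
      ∀ u : ℝ, 0 ≤ u → ∀ v : ℝ,
        ((F' ((ε + u + v) / Real.sqrt 2, (ε + u - v) / Real.sqrt 2) : ℝ) : ℂ) =
          ∫ p, cexp ((((-(u * p 0) : ℝ)) : ℂ) + ((v * p 1 : ℝ) : ℂ) * I) ∂ν := by
    intro ε hε
    refine ⟨μ ε, hfin ε hε, hE ε hε, fun u hu v => ?_⟩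
    rw [← repK ε hε u hu v]
    simp only [hF'_def, hK'_def, mk4_apply_zero, mk4_apply_one, mk4_apply_two, mk4_apply_three]
    rw [← hflip1K (WithLp.toLp 2 ![ε + u, v, 0, 0])]
    congr 2; ext i; fin_cases i <;> simp <;> field_simp <;> (try rw [hsq]) <;> ring
  -- the cones
  have coneK : ∀ ε : ℝ, 0 < ε → μ ε {p : E4 | p 0 < |p 1|} = 0 := by
    intro ε hε
    haveI := hfin ε hε
    obtain ⟨M, hM⟩ := stub_planarDiscSections F (contF K hcont) symF diagF ε hε
    refine stub_coneOfDiscSections (μ ε) (hE ε hε) M fun t ht => ?_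
    obtain ⟨f, hf, hfM, hfb⟩ := hM t ht
    refine ⟨f, hf, hfM, fun b hb => ?_⟩
    rw [hfb b hb]
    exact repK ε hε t ht.le b
  have coneK' : ∀ ε : ℝ, 0 < ε → μ' ε {p : E4 | p 0 < |p 1|} = 0 := by
    intro ε hε
    haveI := hfin' ε hε
    obtain ⟨M, hM⟩ := stub_planarDiscSections F' (contF K' hcont') symF' diagF' ε hε
    refine stub_coneOfDiscSections (μ' ε) (hE' ε hε) M fun t ht => ?_
    obtain ⟨f, hf, hfM, hfb⟩ := hM t ht
    refine ⟨f, hf, hfM, fun b hb => ?_⟩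
    rw [hfb b hb]
    exact repK' ε hε t ht.le b
  ------------------------------------------------------------------
  -- (5) the angle band limit for `K` and `K'`
  ------------------------------------------------------------------
  have ha0 : 0 < a := by linarith
  have ha12 : a < 12 := by linarith
  obtain ⟨b, hb⟩ := stub_angleBandLimit K C a ha0 ha12 hdecay hrotK hflip1K μ hfin hE coneK hrep
  obtain ⟨b', hb'⟩ := stub_angleBandLimit K' C a ha0 ha12 hdecay' hrot' hflip1' μ' hfin' hE' coneK' hrep'
  -- the diagonal trace of `K` is the axis trace of `K'`
  have hb'' : ∀ t : ℝ, 0 < t → ∀ y z : ℝ,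
      (∀ φ : ℝ, K (WithLp.toLp 2 ![t * Real.cos (φ - π / 4), t * Real.sin (φ - π / 4), y, z]) =
        b' 0 t y z + b' 1 t y z * Real.cos (4 * φ) + b' 2 t y z * Real.cos (8 * φ)) ∧
      (∀ χ ε : ℝ, 0 < ε → ε < t * Real.exp (-|χ|) →
        (((b' 0 t y z + b' 1 t y z * Real.cosh (4 * χ) + b' 2 t y z * Real.cosh (8 * χ) : ℝ)) : ℂ) =
          ∫ p, Complex.exp ((((-((t * Real.cosh χ - ε) * p 0 + t * Real.sinh χ * p 1)) : ℝ) : ℂ) +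
            ((y * p 2 + z * p 3 : ℝ) : ℂ) * Complex.I) ∂(μ' ε)) := by
    intro t ht y z
    refine ⟨fun φ => ?_, (hb' t ht y z).2⟩
    rw [← (hb' t ht y z).1 φ]
    simp only [hK'_def, mk4_apply_zero, mk4_apply_one, mk4_apply_two, mk4_apply_three]
    have hc : Real.cos (φ - π / 4) = (Real.cos φ + Real.sin φ) / Real.sqrt 2 := by
      rw [Real.cos_sub, Real.cos_pi_div_four, Real.sin_pi_div_four]
      field_simp
      rw [hsq]
    have hs : Real.sin (φ - π / 4) = (Real.sin φ - Real.cos φ) / Real.sqrt 2 := by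
      rw [Real.sin_sub, Real.cos_pi_div_four, Real.sin_pi_div_four]
      field_simp
      rw [hsq]
    congr 2; ext i; fin_cases i <;> simp [hc, hs] <;> field_simp <;> (try rw [hsq]) <;> ring
  ------------------------------------------------------------------
  -- (6) the transverse pinch
  ------------------------------------------------------------------
  exact stub_transversePinch K C a (by linarith) ha10 hcont hdecay hflip23K μ μ' hfin hfin' coneK coneK'
    b b' hb hb''

end Summit.QuantumFields.YangMills.Cruxes.ShellRigidity.ThalesSlitExactConeType
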